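import Summits.BirchSwinnertonDyer.BirchSwinnertonDyer.Theorems.PrintCf2DisegniPairTwoLawRigidityClasses
import Literature.NumberTheory.EllipticCurves.PadicSigmaSqMinusTwistBoundaryProofs
import Summits.BirchSwinnertonDyer.BirchSwinnertonDyer.Theses.PrintCf2
import HarnessLib

/-!
# Road (C) `disegni-pair-two` on crux stmt-BirchSwinnertonDyer-20368 — the (Δ1) descent law follows from its restriction to the
# EXPLICIT partner models `W_k = [1, −(3k+1), 0, −2(4k+1)², −(4k+1)³]`

Cell `bsd-print-cf2`, width seat `bsd-line-cf2-p1-w8` (g30), `--supports stmt-BirchSwinnertonDyer-20368` (helper). THEOREMS ONLY (no `def`, no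
named fact introduced, no `sorry`); imports the route file directly (for the item-by-name corollary). Sequel of `PrintCf2DisegniPairTwoLawRigidityClasses.lean`.

The registered research stub (Δ1) `stub_law_descent_two` (= route-A support item stmt-BirchSwinnertonDyer-28322
`SplitBadTwoDescentLawSevenFreeOfFacts`) quantifies over every globally minimal model `V` of the good partner `49a1^{(d′)}` together with an
isomorphism `C₁ • V = cm7.quadraticTwist d′`. By the rigidity theorems the left-hand side is model-free, and the switch to the explicit
integral model `W_k` (`d′ = 4k+1`; `cm7Twist_isElliptic`, `cm7Twist_isGloballyMinimal_of_squarefree`, `cm7_quadraticTwist_smul_eq`) costs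
nothing: the given newform `f` is a newform of `W_k` (`isNewformOf_iff_of_smul_eq`), the period ratio is unchanged (`periods_eq_of_smul_eq`),
the member's model and generator are carried along the twisted change `D^{(d*)}`, and `W_k^{(d*)}` carries THE canonical minus-twist datum
(`cm7Twist_existsUnique_isCanonicalSqMinusTwist`). Hence:

* `exists_explicitModel` — the explicit model with its two instances and its isomorphism to `49a1^{(4k+1)}`;
* ★★ `lawDescent_two_of_explicitModel` — (Δ1) VERBATIM from (Δ1) RESTRICTED TO `V = W_k` (no `C₁` binder; class index written with
  `d′ = 4k+1`). A prover of 28322 may therefore work with the explicit coefficients `a₁ = 1, a₂ = −(3k+1), a₃ = 0, a₄ = −2(4k+1)²,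
  a₆ = −(4k+1)³` only.

READING UNCHANGED: 20368 = 12 primary prints + (Δ1); nothing here proves (Δ1), 28322 or the crux; BSD is not proved by any of this.

References: B. Mazur, J. Tate, J. Teitelbaum (1986) §I.13–I.14 [MazurTateTeitelbaum1986Invent]; B. Mazur, W. Stein, J. Tate (2006) §1, §2.7
[MazurSteinTate2006]; B. Perrin-Riou, Mém. SMF 17 (1984) Ch. III §1.2 [Perrinriou1984]; J. H. Silverman, AEC VII.1.3(b) [SilvermanAEC2009].
-/

set_option autoImplicit false
set_option linter.dupNamespace false

noncomputable section

open scoped Classical MatrixGroups ModularForm NumberField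

open CongruenceSubgroup WeierstrassCurve Literature.NumberTheory.EllipticCurves
  Literature.NumberTheory.EllipticCurves.ModularForms

namespace Summit.BirchSwinnertonDyer.BirchSwinnertonDyer.Theorems.PrintCf2.DisegniPairTwo

/-- **The explicit partner model**: for `4k+1` squarefree, `W_k = [1, −(3k+1), 0, −2(4k+1)², −(4k+1)³]` is an elliptic, globally minimal model
with `(1, 0, ½, 0)⁻¹ • W_k = 49a1^{(4k+1)}` (`cm7_quadraticTwist_smul_eq`). [cite: SilvermanAEC2009, VII.1 and III.1]
[cite: Perrinriou1984, Ch. III §1.2 Lemme 2] -/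
theorem exists_explicitModel (k : ℤ) (hsq : Squarefree (4 * k + 1)) :
    ∃ (V : WeierstrassCurve ℚ) (_ : V = ⟨1, -(3 * (k : ℚ) + 1), 0, -2 * (4 * (k : ℚ) + 1) ^ 2, -(4 * (k : ℚ) + 1) ^ 3⟩) (_ : V.IsElliptic)
      (_ : V.IsGloballyMinimal),
      (⟨1, 0, 1 / 2, 0⟩ : VariableChange ℚ)⁻¹ • V = cm7.quadraticTwist (((4 * k + 1 : ℤ)) : ℚ) := by
  set Wk : WeierstrassCurve ℚ := ⟨1, -(3 * (k : ℚ) + 1), 0, -2 * (4 * (k : ℚ) + 1) ^ 2, -(4 * (k : ℚ) + 1) ^ 3⟩ with hWk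
  set A : VariableChange ℚ := ⟨1, 0, 1 / 2, 0⟩ with hA
  have hAV : A • cm7.quadraticTwist (((4 * k + 1 : ℤ)) : ℚ) = Wk := by
    rw [hA, cm7_quadraticTwist_smul_eq k]
    ext <;> simp [WeierstrassCurve.map, hWk]
  exact ⟨Wk, hWk, cm7Twist_isElliptic Wk k hWk, cm7Twist_isGloballyMinimal_of_squarefree Wk k hWk hsq,
    by rw [← hAV, inv_smul_smul]⟩

/-- ★★ **(Δ1) `stub_law_descent_two` VERBATIM from its restriction to the explicit partner models `V = W_k`.** If, with one class function
`e_D`, the `2`-adic valuation identity of (Δ1) holds for every `k` with `4k+1` squarefree and `7 ∤ 4k+1`, at the EXPLICIT globally minimal model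
`W_k = [1, −(3k+1), 0, −2(4k+1)², −(4k+1)³]` of `49a1^{(4k+1)}` (all newforms `f` of `W_k`, all period ratios, all members `C • W = W_k^{(d*)}` of
analytic rank one, all generators, all canonical minus-twist data — exactly (Δ1)'s binders with `V := W_k` and no `C₁`), then (Δ1) holds as
registered (every globally minimal `V` with `C₁ • V = 49a1^{(d′)}`): two minimal models differ by an integral isomorphism and the left-hand
side is rigid (`lawLHS_chi8_rigid`, `lawLHS_chi4_rigid`, `lawLHS_chi8'_rigid`). Nothing here proves (Δ1); BSD is not proved by any of this.
[cite: MazurTateTeitelbaum1986Invent, §I.14] [cite: MazurSteinTate2006, §1] [cite: SilvermanAEC2009, VII.1.3(b)] -/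
theorem lawDescent_two_of_explicitModel
    (hexpl : ∃ e_D : ℤ → ℤ → ℤ,
      (∀ (k : ℤ), Squarefree (4 * k + 1) → ¬ (7 : ℤ) ∣ 4 * k + 1 →
        ∀ (V : WeierstrassCurve ℚ) [V.IsElliptic] [V.IsGloballyMinimal],
          V = ⟨1, -(3 * (k : ℚ) + 1), 0, -2 * (4 * (k : ℚ) + 1) ^ 2, -(4 * (k : ℚ) + 1) ^ 3⟩ →
        ∀ {N : ℕ} [NeZero N] (f : CuspForm (Gamma0 N) 2), IsNewformOf V f →
        ∀ (ϖ : ℚ), ϖ ≠ 0 → (ϖ : ℝ) * V.realPeriodRat = plusPeriod f →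
        ∀ (W : WeierstrassCurve ℚ) [W.IsElliptic] [W.IsGloballyMinimal] [(V.quadraticTwist 2).IsElliptic]
          (C : VariableChange ℚ), C • W = V.quadraticTwist 2 → W.analyticRank = 1 →
        ∀ (P : (V.quadraticTwist 2).toAffine.Point), ¬ IsOfFinAddOrder P →
          (∀ R : (V.quadraticTwist 2).toAffine.Point,
            ∃ (k : ℤ) (T : (V.quadraticTwist 2).toAffine.Point), IsOfFinAddOrder T ∧ R = k • P + T) →
        ∀ (Dc : PAdicHeightData (V.quadraticTwist 2) 2), Dc.IsCanonicalSqMinusTwist →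
          (∑' k : ℕ, PowerSeries.coeff k (padicLFunction f (unitRoot V 2 : ℚ_[2])) * (k : ℚ_[2]) *
              (-2) ^ (k - 1)).valuation + padicValRat 2 ϖ - (Dc.pairing P P).valuation =
            (padicValNat 2 (Nat.card (AddCommGroup.primaryComponent W.sha 2)) : ℤ) +
              (padicValNat 2 W.tamagawaProduct : ℤ) - 2 * (padicValNat 2 W.torsionOrder : ℤ) + e_D 0 ((4 * k + 1) % 8)) ∧
      (∀ (k : ℤ), Squarefree (4 * k + 1) → ¬ (7 : ℤ) ∣ 4 * k + 1 →
        ∀ (V : WeierstrassCurve ℚ) [V.IsElliptic] [V.IsGloballyMinimal],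
          V = ⟨1, -(3 * (k : ℚ) + 1), 0, -2 * (4 * (k : ℚ) + 1) ^ 2, -(4 * (k : ℚ) + 1) ^ 3⟩ →
        ∀ {N : ℕ} [NeZero N] (f : CuspForm (Gamma0 N) 2), IsNewformOf V f →
        ∀ (μ : ℚ), μ ≠ 0 → (μ : ℝ) * V.imaginaryPeriodRat = minusPeriod f →
        ∀ (W : WeierstrassCurve ℚ) [W.IsElliptic] [W.IsGloballyMinimal] [(V.quadraticTwist (-1)).IsElliptic]
          (C : VariableChange ℚ), C • W = V.quadraticTwist (-1) → W.analyticRank = 1 →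
        ∀ (P : (V.quadraticTwist (-1)).toAffine.Point), ¬ IsOfFinAddOrder P →
          (∀ R : (V.quadraticTwist (-1)).toAffine.Point,
            ∃ (k : ℤ) (T : (V.quadraticTwist (-1)).toAffine.Point), IsOfFinAddOrder T ∧ R = k • P + T) →
        ∀ (Dc : PAdicHeightData (V.quadraticTwist (-1)) 2), Dc.IsCanonicalSqMinusTwist →
          (PowerSeries.coeff 1 (padicLFunctionMinusBranch f (unitRoot V 2 : ℚ_[2]) 1)).valuation + padicValRat 2 μ - (Dc.pairing P P).valuation =
            (padicValNat 2 (Nat.card (AddCommGroup.primaryComponent W.sha 2)) : ℤ) +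
              (padicValNat 2 W.tamagawaProduct : ℤ) - 2 * (padicValNat 2 W.torsionOrder : ℤ) + e_D 1 ((-(4 * k + 1)) % 8)) ∧
      (∀ (k : ℤ), Squarefree (4 * k + 1) → ¬ (7 : ℤ) ∣ 4 * k + 1 →
        ∀ (V : WeierstrassCurve ℚ) [V.IsElliptic] [V.IsGloballyMinimal],
          V = ⟨1, -(3 * (k : ℚ) + 1), 0, -2 * (4 * (k : ℚ) + 1) ^ 2, -(4 * (k : ℚ) + 1) ^ 3⟩ →
        ∀ {N : ℕ} [NeZero N] (f : CuspForm (Gamma0 N) 2), IsNewformOf V f →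
        ∀ (μ : ℚ), μ ≠ 0 → (μ : ℝ) * V.imaginaryPeriodRat = minusPeriod f →
        ∀ (W : WeierstrassCurve ℚ) [W.IsElliptic] [W.IsGloballyMinimal] [(V.quadraticTwist (-2)).IsElliptic]
          (C : VariableChange ℚ), C • W = V.quadraticTwist (-2) → W.analyticRank = 1 →
        ∀ (P : (V.quadraticTwist (-2)).toAffine.Point), ¬ IsOfFinAddOrder P →
          (∀ R : (V.quadraticTwist (-2)).toAffine.Point,
            ∃ (k : ℤ) (T : (V.quadraticTwist (-2)).toAffine.Point), IsOfFinAddOrder T ∧ R = k • P + T) →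
        ∀ (Dc : PAdicHeightData (V.quadraticTwist (-2)) 2), Dc.IsCanonicalSqMinusTwist →
          (∑' k : ℕ, PowerSeries.coeff k (padicLFunctionMinusBranch f (unitRoot V 2 : ℚ_[2]) 1) * (k : ℚ_[2]) *
              (-2) ^ (k - 1)).valuation + padicValRat 2 μ - (Dc.pairing P P).valuation =
            (padicValNat 2 (Nat.card (AddCommGroup.primaryComponent W.sha 2)) : ℤ) +
              (padicValNat 2 W.tamagawaProduct : ℤ) - 2 * (padicValNat 2 W.torsionOrder : ℤ) + e_D 0 ((-(4 * k + 1)) % 8))) :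
      ∃ e_D : ℤ → ℤ → ℤ,
      -- the `χ₈∘N`-class: `d = 2d′`, `D = Σ_k k·[T^k]L₂(f,α)·(−2)^{k−1}`, plus period ratio `ϖ`
      (∀ (d' : ℤ), d' % 4 = 1 → Squarefree d' → ¬ (7 : ℤ) ∣ d' →
        ∀ (V : WeierstrassCurve ℚ) [V.IsElliptic] [V.IsGloballyMinimal] (C₁ : VariableChange ℚ),
          C₁ • V = cm7.quadraticTwist (d' : ℚ) →
        ∀ {N : ℕ} [NeZero N] (f : CuspForm (Gamma0 N) 2), IsNewformOf V f →
        ∀ (ϖ : ℚ), ϖ ≠ 0 → (ϖ : ℝ) * V.realPeriodRat = plusPeriod f →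
        ∀ (W : WeierstrassCurve ℚ) [W.IsElliptic] [W.IsGloballyMinimal] [(V.quadraticTwist 2).IsElliptic]
          (C : VariableChange ℚ), C • W = V.quadraticTwist 2 → W.analyticRank = 1 →
        ∀ (P : (V.quadraticTwist 2).toAffine.Point), ¬ IsOfFinAddOrder P →
          (∀ R : (V.quadraticTwist 2).toAffine.Point,
            ∃ (k : ℤ) (T : (V.quadraticTwist 2).toAffine.Point), IsOfFinAddOrder T ∧ R = k • P + T) →
        ∀ (Dc : PAdicHeightData (V.quadraticTwist 2) 2), Dc.IsCanonicalSqMinusTwist →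
          (∑' k : ℕ, PowerSeries.coeff k (padicLFunction f (unitRoot V 2 : ℚ_[2])) * (k : ℚ_[2]) *
              (-2) ^ (k - 1)).valuation + padicValRat 2 ϖ - (Dc.pairing P P).valuation =
            (padicValNat 2 (Nat.card (AddCommGroup.primaryComponent W.sha 2)) : ℤ) +
              (padicValNat 2 W.tamagawaProduct : ℤ) - 2 * (padicValNat 2 W.torsionOrder : ℤ) + e_D 0 (d' % 8)) ∧
      -- the `χ₋₄∘N`-class: `d = −d′`, `D = [T¹]L₂⁻(f,α)` (derivative at `T = 0` of the minus branch), `μ`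
      (∀ (d' : ℤ), d' % 4 = 1 → Squarefree d' → ¬ (7 : ℤ) ∣ d' →
        ∀ (V : WeierstrassCurve ℚ) [V.IsElliptic] [V.IsGloballyMinimal] (C₁ : VariableChange ℚ),
          C₁ • V = cm7.quadraticTwist (d' : ℚ) →
        ∀ {N : ℕ} [NeZero N] (f : CuspForm (Gamma0 N) 2), IsNewformOf V f →
        ∀ (μ : ℚ), μ ≠ 0 → (μ : ℝ) * V.imaginaryPeriodRat = minusPeriod f →
        ∀ (W : WeierstrassCurve ℚ) [W.IsElliptic] [W.IsGloballyMinimal] [(V.quadraticTwist (-1)).IsElliptic]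
          (C : VariableChange ℚ), C • W = V.quadraticTwist (-1) → W.analyticRank = 1 →
        ∀ (P : (V.quadraticTwist (-1)).toAffine.Point), ¬ IsOfFinAddOrder P →
          (∀ R : (V.quadraticTwist (-1)).toAffine.Point,
            ∃ (k : ℤ) (T : (V.quadraticTwist (-1)).toAffine.Point), IsOfFinAddOrder T ∧ R = k • P + T) →
        ∀ (Dc : PAdicHeightData (V.quadraticTwist (-1)) 2), Dc.IsCanonicalSqMinusTwist →
          (PowerSeries.coeff 1 (padicLFunctionMinusBranch f (unitRoot V 2 : ℚ_[2]) 1)).valuation + padicValRat 2 μ - (Dc.pairing P P).valuation =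
            (padicValNat 2 (Nat.card (AddCommGroup.primaryComponent W.sha 2)) : ℤ) +
              (padicValNat 2 W.tamagawaProduct : ℤ) - 2 * (padicValNat 2 W.torsionOrder : ℤ) + e_D 1 ((-d') % 8)) ∧
      -- the `χ₋₈∘N`-class: `d = −2d′`, `D = Σ_k k·[T^k]L₂⁻(f,α)·(−2)^{k−1}`, `μ`
      (∀ (d' : ℤ), d' % 4 = 1 → Squarefree d' → ¬ (7 : ℤ) ∣ d' →
        ∀ (V : WeierstrassCurve ℚ) [V.IsElliptic] [V.IsGloballyMinimal] (C₁ : VariableChange ℚ),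
          C₁ • V = cm7.quadraticTwist (d' : ℚ) →
        ∀ {N : ℕ} [NeZero N] (f : CuspForm (Gamma0 N) 2), IsNewformOf V f →
        ∀ (μ : ℚ), μ ≠ 0 → (μ : ℝ) * V.imaginaryPeriodRat = minusPeriod f →
        ∀ (W : WeierstrassCurve ℚ) [W.IsElliptic] [W.IsGloballyMinimal] [(V.quadraticTwist (-2)).IsElliptic]
          (C : VariableChange ℚ), C • W = V.quadraticTwist (-2) → W.analyticRank = 1 →
        ∀ (P : (V.quadraticTwist (-2)).toAffine.Point), ¬ IsOfFinAddOrder P →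
          (∀ R : (V.quadraticTwist (-2)).toAffine.Point,
            ∃ (k : ℤ) (T : (V.quadraticTwist (-2)).toAffine.Point), IsOfFinAddOrder T ∧ R = k • P + T) →
        ∀ (Dc : PAdicHeightData (V.quadraticTwist (-2)) 2), Dc.IsCanonicalSqMinusTwist →
          (∑' k : ℕ, PowerSeries.coeff k (padicLFunctionMinusBranch f (unitRoot V 2 : ℚ_[2]) 1) * (k : ℚ_[2]) *
              (-2) ^ (k - 1)).valuation + padicValRat 2 μ - (Dc.pairing P P).valuation =
            (padicValNat 2 (Nat.card (AddCommGroup.primaryComponent W.sha 2)) : ℤ) +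
              (padicValNat 2 W.tamagawaProduct : ℤ) - 2 * (padicValNat 2 W.torsionOrder : ℤ) + e_D 0 ((-d') % 8)) := by
  haveI : Fact (2 : ℕ).Prime := ⟨Nat.prime_two⟩
  obtain ⟨e_D, h8, h4, h8'⟩ := hexpl
  refine ⟨e_D, ?_, ?_, ?_⟩
  · intro d' hd4 hsq h7 V _ _ C₁ hC₁ N _ f hf ϖ hϖ0 hϖ W _ _ _ C hC hr P hP hgen Dc hDc
    obtain ⟨k, rfl⟩ : ∃ k : ℤ, d' = 4 * k + 1 := ⟨d' / 4, by omega⟩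
    obtain ⟨Wk, hWk, _, _, hC₁k⟩ := exists_explicitModel k hsq
    obtain ⟨D, hD, hu, r, s, t, -, -, -⟩ := exists_integral_smul_eq_of_models V Wk C₁ _ hC₁ hC₁k
    have hfk : IsNewformOf Wk f := (isNewformOf_iff_of_smul_eq hD f).mpr hf
    obtain ⟨hΩ, -⟩ := periods_eq_of_smul_eq hD hu
    have hϖk : (ϖ : ℝ) * Wk.realPeriodRat = plusPeriod f := by rw [hΩ]; exact hϖ
    have hDd := twistedChange_smul_quadraticTwist_eq (V := V) (V₂ := Wk) (D := D) (2 : ℚ) hD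
    haveI : (Wk.quadraticTwist 2).IsElliptic := Wk.isElliptic_quadraticTwist two_ne_zero
    set φ := (VariableChange.pointEquiv (V.quadraticTwist 2) ⟨D.u, (2 : ℚ) * D.r, 0, 0⟩).trans
      (Affine.Point.congrEquiv hDd) with hφ
    have hCk : ((⟨D.u, (2 : ℚ) * D.r, 0, 0⟩ : VariableChange ℚ) * C) • W = Wk.quadraticTwist 2 := by
      rw [mul_smul, hC, hDd]
    have hPk : ¬ IsOfFinAddOrder (φ P) := fun h =>
      hP ((φ.injective.isOfFinAddOrder_iff (f := φ.toAddMonoidHom)).mp h)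
    have hgenk := generator_map φ hgen
    obtain ⟨Dck, hDck, -⟩ := cm7Twist_existsUnique_isCanonicalSqMinusTwist Wk k hWk (d := 2) (Or.inr (Or.inl rfl))
    have hlaw := h8 k hsq h7 Wk hWk f hfk ϖ hϖ0 hϖk W _ hCk hr (φ P) hPk hgenk Dck hDck
    rw [lawLHS_chi8_rigid hd4 hsq V C₁ hC₁ f hf ϖ hϖ P hgen Dc hDc Wk _ hC₁k f hfk ϖ hϖk (φ P) hgenk Dck hDck]
    exact hlaw
  · intro d' hd4 hsq h7 V _ _ C₁ hC₁ N _ f hf μ hμ0 hμ W _ _ _ C hC hr P hP hgen Dc hDc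
    obtain ⟨k, rfl⟩ : ∃ k : ℤ, d' = 4 * k + 1 := ⟨d' / 4, by omega⟩
    obtain ⟨Wk, hWk, _, _, hC₁k⟩ := exists_explicitModel k hsq
    obtain ⟨D, hD, hu, r, s, t, -, -, -⟩ := exists_integral_smul_eq_of_models V Wk C₁ _ hC₁ hC₁k
    have hfk : IsNewformOf Wk f := (isNewformOf_iff_of_smul_eq hD f).mpr hf
    obtain ⟨-, hΩ⟩ := periods_eq_of_smul_eq hD hu
    have hμk : (μ : ℝ) * Wk.imaginaryPeriodRat = minusPeriod f := by rw [hΩ]; exact hμ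
    have hDd := twistedChange_smul_quadraticTwist_eq (V := V) (V₂ := Wk) (D := D) ((-1) : ℚ) hD
    haveI : (Wk.quadraticTwist (-1)).IsElliptic := Wk.isElliptic_quadraticTwist (by norm_num)
    set φ := (VariableChange.pointEquiv (V.quadraticTwist (-1)) ⟨D.u, ((-1) : ℚ) * D.r, 0, 0⟩).trans
      (Affine.Point.congrEquiv hDd) with hφ
    have hCk : ((⟨D.u, ((-1) : ℚ) * D.r, 0, 0⟩ : VariableChange ℚ) * C) • W = Wk.quadraticTwist (-1) := by
      rw [mul_smul, hC, hDd]
    have hPk : ¬ IsOfFinAddOrder (φ P) := fun h =>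
      hP ((φ.injective.isOfFinAddOrder_iff (f := φ.toAddMonoidHom)).mp h)
    have hgenk := generator_map φ hgen
    obtain ⟨Dck, hDck, -⟩ := cm7Twist_existsUnique_isCanonicalSqMinusTwist Wk k hWk (d := -1) (Or.inl rfl)
    have hlaw := h4 k hsq h7 Wk hWk f hfk μ hμ0 hμk W _ hCk hr (φ P) hPk hgenk Dck hDck
    rw [lawLHS_chi4_rigid hd4 hsq V C₁ hC₁ f hf μ hμ P hgen Dc hDc Wk _ hC₁k f hfk μ hμk (φ P) hgenk Dck hDck]
    exact hlaw
  · intro d' hd4 hsq h7 V _ _ C₁ hC₁ N _ f hf μ hμ0 hμ W _ _ _ C hC hr P hP hgen Dc hDc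
    obtain ⟨k, rfl⟩ : ∃ k : ℤ, d' = 4 * k + 1 := ⟨d' / 4, by omega⟩
    obtain ⟨Wk, hWk, _, _, hC₁k⟩ := exists_explicitModel k hsq
    obtain ⟨D, hD, hu, r, s, t, -, -, -⟩ := exists_integral_smul_eq_of_models V Wk C₁ _ hC₁ hC₁k
    have hfk : IsNewformOf Wk f := (isNewformOf_iff_of_smul_eq hD f).mpr hf
    obtain ⟨-, hΩ⟩ := periods_eq_of_smul_eq hD hu
    have hμk : (μ : ℝ) * Wk.imaginaryPeriodRat = minusPeriod f := by rw [hΩ]; exact hμ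
    have hDd := twistedChange_smul_quadraticTwist_eq (V := V) (V₂ := Wk) (D := D) ((-2) : ℚ) hD
    haveI : (Wk.quadraticTwist (-2)).IsElliptic := Wk.isElliptic_quadraticTwist (by norm_num)
    set φ := (VariableChange.pointEquiv (V.quadraticTwist (-2)) ⟨D.u, ((-2) : ℚ) * D.r, 0, 0⟩).trans
      (Affine.Point.congrEquiv hDd) with hφ
    have hCk : ((⟨D.u, ((-2) : ℚ) * D.r, 0, 0⟩ : VariableChange ℚ) * C) • W = Wk.quadraticTwist (-2) := by
      rw [mul_smul, hC, hDd]
    have hPk : ¬ IsOfFinAddOrder (φ P) := fun h =>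
      hP ((φ.injective.isOfFinAddOrder_iff (f := φ.toAddMonoidHom)).mp h)
    have hgenk := generator_map φ hgen
    obtain ⟨Dck, hDck, -⟩ := cm7Twist_existsUnique_isCanonicalSqMinusTwist Wk k hWk (d := -2) (Or.inr (Or.inr rfl))
    have hlaw := h8' k hsq h7 Wk hWk f hfk μ hμ0 hμk W _ hCk hr (φ P) hPk hgenk Dck hDck
    rw [lawLHS_chi8'_rigid hd4 hsq V C₁ hC₁ f hf μ hμ P hgen Dc hDc Wk _ hC₁k f hfk μ hμk (φ P) hgenk Dck hDck]
    exact hlaw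


/-- ★ **The route-A support item stmt-BirchSwinnertonDyer-28322 `PrintCf2.SplitBadTwoDescentLawSevenFreeOfFacts` BY NAME from (Δ1) restricted
to the explicit partner models `W_k`** (`lawDescent_two_of_explicitModel`; the item's `def` is the (Δ1) text verbatim). Nothing here proves 28322.
[cite: MazurTateTeitelbaum1986Invent, §I.14] [cite: MazurSteinTate2006, §1] -/
theorem splitBadTwoDescentLawSevenFreeOfFacts_of_explicitModel
    (hexpl : ∃ e_D : ℤ → ℤ → ℤ,
      (∀ (k : ℤ), Squarefree (4 * k + 1) → ¬ (7 : ℤ) ∣ 4 * k + 1 →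
        ∀ (V : WeierstrassCurve ℚ) [V.IsElliptic] [V.IsGloballyMinimal],
          V = ⟨1, -(3 * (k : ℚ) + 1), 0, -2 * (4 * (k : ℚ) + 1) ^ 2, -(4 * (k : ℚ) + 1) ^ 3⟩ →
        ∀ {N : ℕ} [NeZero N] (f : CuspForm (Gamma0 N) 2), IsNewformOf V f →
        ∀ (ϖ : ℚ), ϖ ≠ 0 → (ϖ : ℝ) * V.realPeriodRat = plusPeriod f →
        ∀ (W : WeierstrassCurve ℚ) [W.IsElliptic] [W.IsGloballyMinimal] [(V.quadraticTwist 2).IsElliptic]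
          (C : VariableChange ℚ), C • W = V.quadraticTwist 2 → W.analyticRank = 1 →
        ∀ (P : (V.quadraticTwist 2).toAffine.Point), ¬ IsOfFinAddOrder P →
          (∀ R : (V.quadraticTwist 2).toAffine.Point,
            ∃ (k : ℤ) (T : (V.quadraticTwist 2).toAffine.Point), IsOfFinAddOrder T ∧ R = k • P + T) →
        ∀ (Dc : PAdicHeightData (V.quadraticTwist 2) 2), Dc.IsCanonicalSqMinusTwist →
          (∑' k : ℕ, PowerSeries.coeff k (padicLFunction f (unitRoot V 2 : ℚ_[2])) * (k : ℚ_[2]) *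
              (-2) ^ (k - 1)).valuation + padicValRat 2 ϖ - (Dc.pairing P P).valuation =
            (padicValNat 2 (Nat.card (AddCommGroup.primaryComponent W.sha 2)) : ℤ) +
              (padicValNat 2 W.tamagawaProduct : ℤ) - 2 * (padicValNat 2 W.torsionOrder : ℤ) + e_D 0 ((4 * k + 1) % 8)) ∧
      (∀ (k : ℤ), Squarefree (4 * k + 1) → ¬ (7 : ℤ) ∣ 4 * k + 1 →
        ∀ (V : WeierstrassCurve ℚ) [V.IsElliptic] [V.IsGloballyMinimal],
          V = ⟨1, -(3 * (k : ℚ) + 1), 0, -2 * (4 * (k : ℚ) + 1) ^ 2, -(4 * (k : ℚ) + 1) ^ 3⟩ →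
        ∀ {N : ℕ} [NeZero N] (f : CuspForm (Gamma0 N) 2), IsNewformOf V f →
        ∀ (μ : ℚ), μ ≠ 0 → (μ : ℝ) * V.imaginaryPeriodRat = minusPeriod f →
        ∀ (W : WeierstrassCurve ℚ) [W.IsElliptic] [W.IsGloballyMinimal] [(V.quadraticTwist (-1)).IsElliptic]
          (C : VariableChange ℚ), C • W = V.quadraticTwist (-1) → W.analyticRank = 1 →
        ∀ (P : (V.quadraticTwist (-1)).toAffine.Point), ¬ IsOfFinAddOrder P →
          (∀ R : (V.quadraticTwist (-1)).toAffine.Point,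
            ∃ (k : ℤ) (T : (V.quadraticTwist (-1)).toAffine.Point), IsOfFinAddOrder T ∧ R = k • P + T) →
        ∀ (Dc : PAdicHeightData (V.quadraticTwist (-1)) 2), Dc.IsCanonicalSqMinusTwist →
          (PowerSeries.coeff 1 (padicLFunctionMinusBranch f (unitRoot V 2 : ℚ_[2]) 1)).valuation + padicValRat 2 μ - (Dc.pairing P P).valuation =
            (padicValNat 2 (Nat.card (AddCommGroup.primaryComponent W.sha 2)) : ℤ) +
              (padicValNat 2 W.tamagawaProduct : ℤ) - 2 * (padicValNat 2 W.torsionOrder : ℤ) + e_D 1 ((-(4 * k + 1)) % 8)) ∧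
      (∀ (k : ℤ), Squarefree (4 * k + 1) → ¬ (7 : ℤ) ∣ 4 * k + 1 →
        ∀ (V : WeierstrassCurve ℚ) [V.IsElliptic] [V.IsGloballyMinimal],
          V = ⟨1, -(3 * (k : ℚ) + 1), 0, -2 * (4 * (k : ℚ) + 1) ^ 2, -(4 * (k : ℚ) + 1) ^ 3⟩ →
        ∀ {N : ℕ} [NeZero N] (f : CuspForm (Gamma0 N) 2), IsNewformOf V f →
        ∀ (μ : ℚ), μ ≠ 0 → (μ : ℝ) * V.imaginaryPeriodRat = minusPeriod f →
        ∀ (W : WeierstrassCurve ℚ) [W.IsElliptic] [W.IsGloballyMinimal] [(V.quadraticTwist (-2)).IsElliptic]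
          (C : VariableChange ℚ), C • W = V.quadraticTwist (-2) → W.analyticRank = 1 →
        ∀ (P : (V.quadraticTwist (-2)).toAffine.Point), ¬ IsOfFinAddOrder P →
          (∀ R : (V.quadraticTwist (-2)).toAffine.Point,
            ∃ (k : ℤ) (T : (V.quadraticTwist (-2)).toAffine.Point), IsOfFinAddOrder T ∧ R = k • P + T) →
        ∀ (Dc : PAdicHeightData (V.quadraticTwist (-2)) 2), Dc.IsCanonicalSqMinusTwist →
          (∑' k : ℕ, PowerSeries.coeff k (padicLFunctionMinusBranch f (unitRoot V 2 : ℚ_[2]) 1) * (k : ℚ_[2]) *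
              (-2) ^ (k - 1)).valuation + padicValRat 2 μ - (Dc.pairing P P).valuation =
            (padicValNat 2 (Nat.card (AddCommGroup.primaryComponent W.sha 2)) : ℤ) +
              (padicValNat 2 W.tamagawaProduct : ℤ) - 2 * (padicValNat 2 W.torsionOrder : ℤ) + e_D 0 ((-(4 * k + 1)) % 8))) :
    Summit.BirchSwinnertonDyer.BirchSwinnertonDyer.Theses.PrintCf2.SplitBadTwoDescentLawSevenFreeOfFacts :=
  lawDescent_two_of_explicitModel hexpl

end Summit.BirchSwinnertonDyer.BirchSwinnertonDyer.Theorems.PrintCf2.DisegniPairTwo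

end
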